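import Summits.Ventures.PercRepro.GenQSolidFacts

/-!
# PercRepro — the solid atoms vanish above the solid bound (night-4 gen 4)
`N4 s = 0` and `B4 s = 0` for `s > 10` when every rank-`4` flat has `≤ 10` points: the certificate modules of the
`t = 5` layer expand `Σ_{s ≤ |G|} C(s, ν+4)·B4 s` and drop the terms `s ≥ 11` with these.
-/
namespace PercRepro.Night4

open Finset ThmH SixFour GenQ PerFlat Star

variable {α : Type*} [DecidableEq α] {M : Matroid α} [M.Finite]

/-- `N4 s = 0` for `s > 10` when solids have `≤ 10` points. -/
theorem N4_eq_zero_of_solids_le (hsolid : ∀ F ∈ flatsQ M 4, F.card ≤ 10) (G : Finset α) {s : ℕ} (hs : 10 < s) :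
    N4 M G s = 0 := by
  unfold N4
  rw [Finset.card_eq_zero, Finset.filter_eq_empty_iff]
  intro F hF h
  have := (hsolid F hF).trans' (Finset.card_le_card (Finset.inter_subset_left (s₂ := G)))
  omega

/-- `B4 s = 0` for `s > 10` when solids have `≤ 10` points. -/
theorem B4_eq_zero_of_solids_le (hsolid : ∀ F ∈ flatsQ M 4, F.card ≤ 10) (G : Finset α) (q : ℕ) {s : ℕ}
    (hs : 10 < s) : B4 M G q s = 0 := by
  have h := B4_le (M := M) G q s
  rw [N4_eq_zero_of_solids_le hsolid G hs, mul_zero] at h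
  omega

end PercRepro.Night4
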